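import Summits.ValiantsHypothesis.ValiantsHypothesis.Theses.KPlusLogSqLaw
import Summits.ValiantsHypothesis.ValiantsHypothesis.Theorems.KPlusLogSqLawTropicalBPadding
import Summits.ValiantsHypothesis.ValiantsHypothesis.Theorems.KPlusLogSqLawTropicalBShadowCap

/-!
# Route «KPlusLogSqLaw», crux `TropicalB` (stmt-ValiantsHypothesis-19771) — REGIME COLLAPSE: the two regime stubs are
# equivalent to each other and to `TropicalB`, which is a ONE-PARAMETER statement

HONEST FRAMING.  Helper file for the registered stubs `stub_tropThin` / `stub_tropFat` of
`Cruxes/TropicalB/Lines/birth.lean` (crux `Summit.ValiantsHypothesis.ValiantsHypothesis.Theses.KPlusLogSqLaw.TropicalB`,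
ledger item `stmt-ValiantsHypothesis-19771`, route `KPlusLogSqLaw`, DRAFT; cell `pub-symmetroid`, seat val-sym-trop-p4 (g2),
2026-08-26).  Every theorem here is an IMPLICATION / EQUIVALENCE between statements that are OPEN; nothing is asserted about
`TropicalB` inside its window, about `Lifting`, `KPlusLogSqLaw`, `MatrixDescartes` (stmt-ValiantsHypothesis-18050) or VP ≠ VNP.

Write `T(m, K)` for the tropical capacity (least `B` with `TropRootLawAt m K B`) and `L = ⌊log₂ m⌋`.  The birth skeleton
splits the crux by REGIME,
* THIN `:= ∃ C, ∀ m K, K ≤ L² → TropRootLawAt m K (2^(C·L²))`   (= `stub_tropThin`, `TropRow ≡ TropRootLawAt` by `Iff.rfl`),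
* FAT  `:= ∃ C, ∀ m K, L² ≤ K → TropRootLawAt m K (2^(C·K))`     (= `stub_tropFat`),
and glues `TropicalB` from THIN ∧ FAT (`TropicalB_of`).  The tree already has `TropicalB → THIN`, `TropicalB → FAT`
(`thinStub_of_tropicalB`, `fatStub_of_tropicalB`, file `…TropicalBShadowCap`) and the format monotonicity
`tropRootLawAt_of_le : m ≤ m' → K ≤ K' → TropRootLawAt m' K' B → TropRootLawAt m K B` (file `…TropicalBPadding`).  Put
together they COLLAPSE the split:

* `tropicalB_of_fatStub`  — **FAT → TropicalB** by CLASS padding: a thin format `K < L²` is dominated by the fat format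
  `(m, L²)`, where FAT gives `2^(C·L²) ≤ 2^(C(K+L²))`;
* `tropicalB_of_thinStub` — **THIN → TropicalB** by SIZE padding: a fat format `L² < K` is dominated by the thin format
  `(2^s, K)`, `s = Nat.sqrt K + 1` (`m < 2^(L+1) ≤ 2^s`, `K < s² = ⌊log₂ 2^s⌋²`), where THIN gives `2^(C·s²) ≤ 2^(4C·K)`;
* hence `thinStub_iff_tropicalB`, `fatStub_iff_tropicalB`, `thinStub_iff_fatStub`: either registered stub ALONE closes the
  crux, and a proof of one is a proof of the other;
* `tropicalB_iff_logSqRow`     — `TropicalB ↔ ∃ C, ∀ m, TropRootLawAt m L² (2^(C·L²))` (the single row `K = ⌊log₂ m⌋²`);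
* `tropicalB_iff_expSqrtTower` — `TropicalB ↔ ∃ C, ∀ K, TropRootLawAt (2^(Nat.sqrt K)) K (2^(C·K))` (the tower of height
  `2^⌊√K⌋`; compare the plan-only SQUARE tower `TropRootLawAt (K^2) K (2^(C·K))` of the route, which `TropicalB` implies
  (`squareTower_of_tropicalB`) but which sits far below: `K² ≪ 2^√K`);
* `tropicalB_iff_diagonal`     — `TropicalB ↔ ∃ C, ∀ s, TropRootLawAt (2^s) (s^2) (2^(C·s^2))`.

READING (located, for the planner / the lead's lane assignment): the thin/fat split of the skeleton carries no information —
the «first open strip `L + 1 < K ≤ L²`» of `stub_tropThin` and the «`O(1)` bits per slope class at `K ≥ L²`» of `stub_tropFat`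
are the same question, namely the single sequence of formats `(2^s, s²)`: do `s²`-slope-class parametric assignment designs
on `2^s` nodes admit at most `2^(O(s²))` sign-alternating dominant breakpoints (slope counting gives `2^(Θ(s³))`)?  The
crux `Lifting` does NOT collapse this way (its tropical row is a hypothesis at the same format).
[folklore] padding / monotonicity bookkeeping; no citation exists for the statements themselves (cell conjectures).
-/

set_option linter.dupNamespace false
set_option autoImplicit false

namespace Summit.ValiantsHypothesis.ValiantsHypothesis.Theorems.KPlusLogSqLaw

open Summit.ValiantsHypothesis.ValiantsHypothesis.Theorems.LacunarySymmetroidMatrixDescartes.TropicalCensus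
open Summit.ValiantsHypothesis.ValiantsHypothesis.Theses.KPlusLogSqLaw (TropicalB)

/-! ## 0. Arithmetic of the padded formats -/

/-- If `⌊log₂ m⌋² ≤ K` then `m ≤ 2^(Nat.sqrt K + 1)`. [folklore] -/
theorem le_two_pow_sqrt_succ {m K : ℕ} (h : Nat.log 2 m ^ 2 ≤ K) : m ≤ 2 ^ (Nat.sqrt K + 1) := by
  have h1 : Nat.log 2 m ≤ Nat.sqrt K := Nat.le_sqrt'.mpr h
  exact (Nat.lt_pow_succ_log_self one_lt_two m).le.trans (Nat.pow_le_pow_right two_pos (by omega))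

/-- `K ≤ (Nat.sqrt K + 1)²`. [folklore] -/
theorem le_sqrt_succ_sq (K : ℕ) : K ≤ (Nat.sqrt K + 1) ^ 2 := (Nat.lt_succ_sqrt' K).le

/-- `(Nat.sqrt K + 1)² ≤ 3 K + 1`. [folklore] -/
theorem sqrt_succ_sq_le (K : ℕ) : (Nat.sqrt K + 1) ^ 2 ≤ 3 * K + 1 := by
  have h1 : Nat.sqrt K ^ 2 ≤ K := Nat.sqrt_le' K
  have h2 : Nat.sqrt K ≤ K := Nat.sqrt_le_self K
  nlinarith

/-- `⌊log₂ (2^s)⌋ = s`. [folklore] -/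
theorem log_two_pow (s : ℕ) : Nat.log 2 (2 ^ s) = s := Nat.log_pow one_lt_two s

/-! ## 1. Each regime stub alone gives `TropicalB` -/

/-- **FAT → TB (class padding).**  If `∃ C, ∀ m K, ⌊log₂ m⌋² ≤ K → T(m,K) ≤ 2^(C·K)` then `TropicalB` holds with the same
`C`: a format with `K < ⌊log₂ m⌋²` classes is padded with absent classes up to `K' = ⌊log₂ m⌋²`. [folklore] -/
theorem tropicalB_of_fatStub
    (h : ∃ C : ℕ, ∀ m K : ℕ, Nat.log 2 m ^ 2 ≤ K → TropRootLawAt m K (2 ^ (C * K))) : TropicalB := by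
  obtain ⟨C, hC⟩ := h
  refine ⟨C, fun m K => ?_⟩
  show TropRootLawAt m K (2 ^ (C * (K + Nat.log 2 m ^ 2)))
  rcases le_total (Nat.log 2 m ^ 2) K with hK | hK
  · exact tropRootLawAt_mono (Nat.pow_le_pow_right two_pos (by nlinarith)) (hC m K hK)
  · have h1 : TropRootLawAt m K (2 ^ (C * Nat.log 2 m ^ 2)) :=
      tropRootLawAt_of_le le_rfl hK (hC m (Nat.log 2 m ^ 2) le_rfl)
    exact tropRootLawAt_mono (Nat.pow_le_pow_right two_pos (by nlinarith)) h1

/-- **THIN → TB (size padding).**  If `∃ C, ∀ m K, K ≤ ⌊log₂ m⌋² → T(m,K) ≤ 2^(C·⌊log₂ m⌋²)` then `TropicalB` holds with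
`4C`: a format with `⌊log₂ m⌋² < K` is padded with forced diagonal entries up to size `2^s`, `s = Nat.sqrt K + 1`, where
`K ≤ s² = ⌊log₂ 2^s⌋²` and `s² ≤ 3K + 1 ≤ 4K`. [folklore] -/
theorem tropicalB_of_thinStub
    (h : ∃ C : ℕ, ∀ m K : ℕ, K ≤ Nat.log 2 m ^ 2 → TropRootLawAt m K (2 ^ (C * Nat.log 2 m ^ 2))) : TropicalB := by
  obtain ⟨C, hC⟩ := h
  refine ⟨4 * C, fun m K => ?_⟩
  show TropRootLawAt m K (2 ^ (4 * C * (K + Nat.log 2 m ^ 2)))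
  rcases Nat.eq_zero_or_pos K with rfl | hK0
  · exact tropRootLawAt_zero m _
  rcases le_total K (Nat.log 2 m ^ 2) with hK | hK
  · exact tropRootLawAt_mono (Nat.pow_le_pow_right two_pos (by nlinarith)) (hC m K hK)
  · set s := Nat.sqrt K + 1 with hs
    have hKs : K ≤ Nat.log 2 (2 ^ s) ^ 2 := by rw [log_two_pow]; exact le_sqrt_succ_sq K
    have h1 : TropRootLawAt m K (2 ^ (C * Nat.log 2 (2 ^ s) ^ 2)) :=
      tropRootLawAt_of_le (le_two_pow_sqrt_succ hK) le_rfl (hC (2 ^ s) K hKs)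
    rw [log_two_pow] at h1
    have h2 : s ^ 2 ≤ 3 * K + 1 := sqrt_succ_sq_le K
    exact tropRootLawAt_mono (Nat.pow_le_pow_right two_pos (by nlinarith)) h1

/-! ## 2. The equivalences -/

/-- **THIN ↔ TB.**  The thin regime stub `stub_tropThin` (over the tree row) is equivalent to `TropicalB`. -/
theorem thinStub_iff_tropicalB :
    (∃ C : ℕ, ∀ m K : ℕ, K ≤ Nat.log 2 m ^ 2 → TropRootLawAt m K (2 ^ (C * Nat.log 2 m ^ 2))) ↔ TropicalB :=
  ⟨tropicalB_of_thinStub, thinStub_of_tropicalB⟩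

/-- **FAT ↔ TB.**  The fat regime stub `stub_tropFat` (over the tree row) is equivalent to `TropicalB`. -/
theorem fatStub_iff_tropicalB :
    (∃ C : ℕ, ∀ m K : ℕ, Nat.log 2 m ^ 2 ≤ K → TropRootLawAt m K (2 ^ (C * K))) ↔ TropicalB :=
  ⟨tropicalB_of_fatStub, fatStub_of_tropicalB⟩

/-- **THIN ↔ FAT.**  The two regime stubs of the birth skeleton are equivalent: a proof of either is a proof of the crux. -/
theorem thinStub_iff_fatStub :
    (∃ C : ℕ, ∀ m K : ℕ, K ≤ Nat.log 2 m ^ 2 → TropRootLawAt m K (2 ^ (C * Nat.log 2 m ^ 2))) ↔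
    (∃ C : ℕ, ∀ m K : ℕ, Nat.log 2 m ^ 2 ≤ K → TropRootLawAt m K (2 ^ (C * K))) :=
  thinStub_iff_tropicalB.trans fatStub_iff_tropicalB.symm

/-! ## 3. `TropicalB` is a one-parameter statement -/

/-- **TB ↔ the log-square row.**  `TropicalB` holds iff the single row `K = ⌊log₂ m⌋²` obeys it:
`∃ C, ∀ m, T(m, ⌊log₂ m⌋²) ≤ 2^(C·⌊log₂ m⌋²)` (class padding below the row, size padding above it). -/
theorem tropicalB_iff_logSqRow :
    TropicalB ↔ ∃ C : ℕ, ∀ m : ℕ, TropRootLawAt m (Nat.log 2 m ^ 2) (2 ^ (C * Nat.log 2 m ^ 2)) := by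
  constructor
  · rintro ⟨C, hC⟩
    refine ⟨2 * C, fun m => tropRootLawAt_mono (Nat.pow_le_pow_right two_pos ?_) (hC m (Nat.log 2 m ^ 2))⟩
    nlinarith
  · rintro ⟨C, hC⟩
    exact tropicalB_of_thinStub ⟨C, fun m K hK => tropRootLawAt_of_le le_rfl hK (hC m)⟩

/-- **TB ↔ the exponential-sqrt tower.**  `TropicalB` holds iff `∃ C, ∀ K, T(2^⌊√K⌋, K) ≤ 2^(C·K)`: every format
`(m, K)` is dominated by the tower format at `K' = K + (⌊log₂ m⌋ + 1)²` (`m < 2^(⌊log₂ m⌋+1) ≤ 2^⌊√K'⌋`).  The route's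
plan-only SQUARE tower `T(K², K) ≤ 2^(C·K)` is the same shape at the much smaller height `K²`. -/
theorem tropicalB_iff_expSqrtTower :
    TropicalB ↔ ∃ C : ℕ, ∀ K : ℕ, TropRootLawAt (2 ^ Nat.sqrt K) K (2 ^ (C * K)) := by
  constructor
  · rintro ⟨C, hC⟩
    refine ⟨2 * C, fun K => tropRootLawAt_mono (Nat.pow_le_pow_right two_pos ?_) (hC (2 ^ Nat.sqrt K) K)⟩
    rw [log_two_pow]
    have := Nat.sqrt_le' K
    nlinarith
  · rintro ⟨C, hC⟩
    refine ⟨5 * C, fun m K => ?_⟩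
    show TropRootLawAt m K (2 ^ (5 * C * (K + Nat.log 2 m ^ 2)))
    rcases Nat.eq_zero_or_pos K with rfl | hK0
    · exact tropRootLawAt_zero m _
    set L := Nat.log 2 m with hL
    set K' := K + (L + 1) ^ 2 with hK'
    have hsq : L + 1 ≤ Nat.sqrt K' := Nat.le_sqrt'.mpr (by omega)
    have hm : m ≤ 2 ^ Nat.sqrt K' :=
      (Nat.lt_pow_succ_log_self one_lt_two m).le.trans (Nat.pow_le_pow_right two_pos hsq)
    have h1 : TropRootLawAt m K (2 ^ (C * K')) := tropRootLawAt_of_le hm (by omega) (hC K')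
    refine tropRootLawAt_mono (Nat.pow_le_pow_right two_pos ?_) h1
    have h2 : K' ≤ 5 * (K + L ^ 2) := by rw [hK']; nlinarith
    calc C * K' ≤ C * (5 * (K + L ^ 2)) := Nat.mul_le_mul_left C h2
      _ = 5 * C * (K + L ^ 2) := by ring

/-- **TB ↔ the diagonal.**  `TropicalB` holds iff `∃ C, ∀ s, T(2^s, s²) ≤ 2^(C·s²)`: every format `(m, K)` is dominated by
the diagonal format at `s = ⌊log₂ m⌋ + Nat.sqrt K + 1` (`m < 2^(⌊log₂ m⌋+1) ≤ 2^s`, `K < (Nat.sqrt K + 1)² ≤ s²`, and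
`s² ≤ 6 (K + ⌊log₂ m⌋²)` once `K ≥ 1`).  So the crux is the statement that `s²`-slope-class parametric assignment designs on
`2^s` nodes have at most `2^(O(s²))` sign-alternating dominant breakpoints (slope counting: `2^(Θ(s³))`). -/
theorem tropicalB_iff_diagonal :
    TropicalB ↔ ∃ C : ℕ, ∀ s : ℕ, TropRootLawAt (2 ^ s) (s ^ 2) (2 ^ (C * s ^ 2)) := by
  constructor
  · rintro ⟨C, hC⟩
    refine ⟨2 * C, fun s => tropRootLawAt_mono (Nat.pow_le_pow_right two_pos ?_) (hC (2 ^ s) (s ^ 2))⟩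
    rw [log_two_pow]
    nlinarith
  · rintro ⟨C, hC⟩
    refine ⟨6 * C, fun m K => ?_⟩
    show TropRootLawAt m K (2 ^ (6 * C * (K + Nat.log 2 m ^ 2)))
    rcases Nat.eq_zero_or_pos K with rfl | hK0
    · exact tropRootLawAt_zero m _
    set L := Nat.log 2 m with hL
    set s := L + Nat.sqrt K + 1 with hs
    have hm : m ≤ 2 ^ s := (Nat.lt_pow_succ_log_self one_lt_two m).le.trans (Nat.pow_le_pow_right two_pos (by omega))
    have hK : K ≤ s ^ 2 :=
      (le_sqrt_succ_sq K).trans (Nat.pow_le_pow_left (by omega) 2)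
    have h1 : TropRootLawAt m K (2 ^ (C * s ^ 2)) := tropRootLawAt_of_le hm hK (hC s)
    refine tropRootLawAt_mono (Nat.pow_le_pow_right two_pos ?_) h1
    have h2 : Nat.sqrt K ^ 2 ≤ K := Nat.sqrt_le' K
    have h3 : s ^ 2 ≤ 3 * (L ^ 2 + Nat.sqrt K ^ 2 + 1) := by
      rw [hs]; nlinarith [sq_nonneg ((L : ℤ) - Nat.sqrt K), sq_nonneg ((L : ℤ) - 1), sq_nonneg ((Nat.sqrt K : ℤ) - 1)]
    nlinarith

end Summit.ValiantsHypothesis.ValiantsHypothesis.Theorems.KPlusLogSqLaw
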